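import Mathlib
import Summits.Ventures.HodgeRepro.Tier4.Line4.L1Class
import Summits.Ventures.HodgeRepro.Tier4.Line4.ArchApproxBump

/-!
# Tier4/Line4/ProductWitness — C-L4-PRODWITNESS: the `f₂`-side of the natural level witness `f₂ N = e ⊗ 1_{K(N)}`

Blind re-derivation cell `pub-hodge-repro`, Tier 4 «prove the step» (README §9–§10), seat t4-L1-p1 (prover, LINE L1,
gen 4; self-cut S15153 on the plate of (7b) after C-L4-ARCHAPPROX landed).  Tree path
`lean/Summits/Ventures/HodgeRepro/Tier4/Line4/ProductWitness.lean`.  Mathlib-level; no literature.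

WHAT IS PROVED (every declaration sorry-free, axioms `[propext, Classical.choice, Quot.sound]`).
* `levelK_antitone (h : M ∣ N) : levelK W N ≤ levelK W M` (typer-2's `modSet_antitone`); in particular
  `K(N) ≤ K(1)` for every `N`.
* `levelInd N` — the PLAIN indicator `1_{K(N)}` of the finite coordinate, as a function on `G(𝔸)`
  (`x ↦ if x_f ∈ K(N) then 1 else 0`): `levelInd_ofFinPart` (a function of the finite coordinate only),
  `norm_levelInd_le` (sup-norm `≤ 1`), `mem_levelK_of_levelInd_ne_zero` (the `suppFin₂` shape of `TailFamily'`),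
  `levelInd_mul_of_mem` (right `K(N)`-invariance, the `rightInv₂` shape), `continuous_levelInd` /
  `isFinFactor_levelInd` for `N ≠ 0` (`K(N)` is clopen in `G(𝔸_f)`: `isCompactOpenIn_levelK`, `isClosed_levelK`).
* the PRODUCT laws for an archimedean factor `e` and a finite factor `f`: `isTestFn_prodFn` (`test₂`: continuity and
  compact support through `gaSplit`), `prodFn_mul_of_mem_infinitePart` / `prodFn_mul_of_mem_finitePart` (the two
  coordinate laws), `prodFn_equiv₂` (`equiv₂`: the right-`(T′_w, −e′)`-equivariance of `e ⊗ f` from that of `e`, the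
  shape ArchApprox's `exists_infFactor_weightEquivariant_archFactor_convInf_ne_zero` delivers),
  `prodFn_levelInd_mul_of_mem_levelK` (`rightInv₂` for `e ⊗ 1_{K(N)}`), `exists_bound_prodFn_levelInd` (`sup₂`, uniform
  in `N`), `exists_compact_tsupport_prodFn_levelInd` (`supp₂`: one compact `gaSplit⁻¹(supp e × K(1))` carries every
  `tsupport (e ⊗ 1_{K(N)})`), `ofFinPart_mem_levelK_of_prodFn_levelInd_ne_zero` (`suppFin₂`).

NOT here: the `ffin`-side of the witness (L2-p1's `ffinLevel`: `continuous_ffinLevel`, `ffinLevel_ofFinPart`, the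
double-coset support; `l1` = the LevelVolume display) and the packaging into `TailFamily'` (or v0.35's `lev`-indexed
twin) — plan-4's call; the pieces are stated per level `N` (with `N ≠ 0` where continuity enters: `K(0)` is not open)
and compose with any level function.  Junk: `e = 0` is fine everywhere; `N = 0` is excluded only where stated.

Nothing here says anything about the status of the Hodge conjecture for CM abelian varieties, which is NOT proved
(HC_CM is NOT proved by anyone in this repository).
-/

set_option autoImplicit false
noncomputable section
namespace Summit.Ventures.HodgeRepro.Tier4.Line4
open Summit.Ventures.HodgeRepro.Tier4 Summit.Ventures.HodgeRepro.Tier4.Common Summit.Ventures.HodgeRepro.Tier4.Line1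
  Summit.Ventures.HodgeRepro.Tier4.Line4.L1Class MeasureTheory NumberField
open scoped ComplexConjugate Topology Pointwise

section ProductWitness

variable {k : Type} [Field k] [NumberField k] (W : PlaneData k)

/-! ### The level subgroups are antitone -/

/-- the congruence condition is antitone in the level: `M ∣ N ⇒ IsCongr N A → IsCongr M A`. -/
theorem IsCongr.of_dvd' {M N : ℕ} (h : M ∣ N) {A : M4 k} (hA : IsCongr k N A) : IsCongr k M A :=
  fun i j => ⟨(hA i j).1, modSet_antitone k h (hA i j).2⟩

/-- **`K(N)` is antitone in the level**: `M ∣ N ⇒ K(N) ≤ K(M)`. -/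
theorem levelK_antitone {M N : ℕ} (h : M ∣ N) : levelK W N ≤ levelK W M := by
  intro g hg
  obtain ⟨h1, h2⟩ := (mem_levelK W N g).1 hg
  exact (mem_levelK W M g).2 ⟨IsCongr.of_dvd' h h1, IsCongr.of_dvd' h h2⟩

/-! ### The plain level indicator `1_{K(N)}` of the finite coordinate -/

/-- **the plain level indicator**: `levelInd N x = 1` if `x_f ∈ K(N)`, `0` otherwise (the finite factor of the natural
second test `f₂ N = e ⊗ 1_{K(N)}`), as the indicator of the set `{x : x_f ∈ K(N)}`. -/
def levelInd (N : ℕ) (x : GA W) : ℂ :=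
  (GA.ofFinPart W ⁻¹' (levelK W N : Set (GA W))).indicator (fun _ => (1 : ℂ)) x

/-- `levelInd N x = 1` on `K(N)`. -/
theorem levelInd_eq_one_of_mem {N : ℕ} {x : GA W} (h : GA.ofFinPart W x ∈ levelK W N) : levelInd W N x = 1 := by
  unfold levelInd
  exact Set.indicator_of_mem (Set.mem_preimage.2 h) _

/-- `levelInd N x = 0` off `K(N)`. -/
theorem levelInd_eq_zero_of_notMem {N : ℕ} {x : GA W} (h : GA.ofFinPart W x ∉ levelK W N) :
    levelInd W N x = 0 := by
  unfold levelInd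
  exact Set.indicator_of_notMem (fun h' => h (Set.mem_preimage.1 h')) _

/-- `levelInd` is a function of the finite coordinate only. -/
theorem levelInd_ofFinPart (N : ℕ) (x : GA W) : levelInd W N (GA.ofFinPart W x) = levelInd W N x := by
  have hff : GA.ofFinPart W (GA.ofFinPart W x) = GA.ofFinPart W x :=
    ofFinPart_eq_self_of_mem_finitePart W (ofFinPart_mem_finitePart W x)
  by_cases h : GA.ofFinPart W x ∈ levelK W N
  · rw [levelInd_eq_one_of_mem W h, levelInd_eq_one_of_mem W (by rwa [hff])]
  · rw [levelInd_eq_zero_of_notMem W h, levelInd_eq_zero_of_notMem W (by rwa [hff])]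

/-- the sup-norm of `levelInd` is `≤ 1`. -/
theorem norm_levelInd_le (N : ℕ) (x : GA W) : ‖levelInd W N x‖ ≤ 1 := by
  by_cases h : GA.ofFinPart W x ∈ levelK W N
  · rw [levelInd_eq_one_of_mem W h, norm_one]
  · rw [levelInd_eq_zero_of_notMem W h, norm_zero]
    exact zero_le_one

/-- where `levelInd N` does not vanish, the finite coordinate lies in `K(N)` (the `suppFin₂` shape). -/
theorem mem_levelK_of_levelInd_ne_zero {N : ℕ} {x : GA W} (h : levelInd W N x ≠ 0) :
    GA.ofFinPart W x ∈ levelK W N := by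
  by_contra hx
  exact h (levelInd_eq_zero_of_notMem W hx)

/-- **right `K(N)`-invariance** of `levelInd N` (the `rightInv₂` shape). -/
theorem levelInd_mul_of_mem {N : ℕ} {κ : GA W} (hκ : κ ∈ levelK W N) (x : GA W) :
    levelInd W N (x * κ) = levelInd W N x := by
  have hκf : κ ∈ finitePart W := levelK_le_finitePart W N hκ
  have hfin : GA.ofFinPart W (x * κ) = GA.ofFinPart W x * κ := by
    rw [ofFinPart_mul, ofFinPart_eq_self_of_mem_finitePart W hκf]
  by_cases h : GA.ofFinPart W x ∈ levelK W N
  · rw [levelInd_eq_one_of_mem W h, levelInd_eq_one_of_mem W (by rw [hfin]; exact (levelK W N).mul_mem h hκ)]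
  · rw [levelInd_eq_zero_of_notMem W h, levelInd_eq_zero_of_notMem W]
    rw [hfin]
    intro h'
    apply h
    have := (levelK W N).mul_mem h' ((levelK W N).inv_mem hκ)
    rwa [mul_inv_cancel_right] at this

/-- the set `{x : x_f ∈ K(N)}` is the preimage of the open `finCongr W N` under `x ↦ x_f`. -/
theorem preimage_ofFinPart_levelK_eq (N : ℕ) :
    GA.ofFinPart W ⁻¹' (levelK W N : Set (GA W)) = GA.ofFinPart W ⁻¹' finCongr W N := by
  ext x
  have hmem : (⟨GA.ofFinPart W x, ofFinPart_mem_finitePart W x⟩ : finitePart W) ∈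
      (Subtype.val : finitePart W → GA W) ⁻¹' (levelK W N : Set (GA W)) ↔
      (⟨GA.ofFinPart W x, ofFinPart_mem_finitePart W x⟩ : finitePart W) ∈
      (Subtype.val : finitePart W → GA W) ⁻¹' finCongr W N := by
    rw [preimage_levelK_eq]
  simpa using hmem

/-- `{x : x_f ∈ K(N)}` is clopen in `G(𝔸)` for `N ≠ 0`. -/
theorem isClopen_preimage_ofFinPart_levelK {N : ℕ} (hN : N ≠ 0) :
    IsClopen (GA.ofFinPart W ⁻¹' (levelK W N : Set (GA W))) := by
  refine ⟨(isClosed_levelK W hN).preimage (continuous_ofFinPart W), ?_⟩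
  rw [preimage_ofFinPart_levelK_eq]
  exact (isOpen_finCongr W hN).preimage (continuous_ofFinPart W)

/-- **`levelInd N` is continuous** for `N ≠ 0` (the indicator of a clopen set). -/
theorem continuous_levelInd {N : ℕ} (hN : N ≠ 0) : Continuous (levelInd W N) :=
  (isClopen_preimage_ofFinPart_levelK W hN).continuous_indicator continuous_const

/-- **`levelInd N` is a compactly supported finite factor** for `N ≠ 0` (`IsFinFactor`: continuous, a function of
the finite coordinate, support inside the compact `K(N) ⊆ G(𝔸_f)`). -/
theorem isFinFactor_levelInd {N : ℕ} (hN : N ≠ 0) : IsFinFactor W (levelInd W N) := by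
  refine ⟨continuous_levelInd W hN, fun x => (levelInd_ofFinPart W N x).symm, ?_⟩
  -- the support in `G(𝔸_f)` is `K(N)`, compact
  have hK : IsCompact ((Subtype.val : finitePart W → GA W) ⁻¹' (levelK W N : Set (GA W))) := by
    have hcl : IsClosed ((Subtype.val : finitePart W → GA W) ⁻¹' (levelK W N : Set (GA W))) :=
      (isClosed_levelK W hN).preimage continuous_subtype_val
    have hsub : (Subtype.val : finitePart W → GA W) ⁻¹' (levelK W N : Set (GA W)) ⊆
        Set.range (fun g : levelK W N => (⟨(g : GA W), levelK_le_finitePart W N g.2⟩ : finitePart W)) := by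
      intro y hy
      exact ⟨⟨(y : GA W), hy⟩, Subtype.ext rfl⟩
    have hrange : IsCompact (Set.range (fun g : levelK W N =>
        (⟨(g : GA W), levelK_le_finitePart W N g.2⟩ : finitePart W))) := by
      haveI : CompactSpace (levelK W N) := isCompact_iff_compactSpace.1 (isCompact_levelK W hN)
      exact isCompact_range (continuous_subtype_val.subtype_mk _)
    exact hrange.of_isClosed_subset hcl hsub
  refine HasCompactSupport.intro hK fun y hy => ?_
  show levelInd W N (y : GA W) = 0
  apply levelInd_eq_zero_of_notMem
  rw [ofFinPart_eq_self_of_mem_finitePart W y.2]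
  exact hy

/-! ### The product of an archimedean and a finite factor -/

/-- `G(𝔸) → G_∞ × G_f`, the two coordinates as subtype elements. -/
theorem gaSplit_apply' (x : GA W) :
    gaSplit W x = (⟨GA.ofInfPart W x, GA.ofInfPart_mem_infinitePart W x⟩,
      ⟨GA.ofFinPart W x, ofFinPart_mem_finitePart W x⟩) := by
  refine Prod.ext (Subtype.ext ?_) (Subtype.ext ?_)
  · exact coe_gaSplit_fst W x
  · exact coe_gaSplit_snd W x

/-- **`e ⊗ f` is a test function on `G(𝔸)`** for an archimedean factor `e` and a finite factor `f` (the `test₂`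
shape): continuous, with support inside the compact `gaSplit⁻¹ (supp e × supp f)`. -/
theorem isTestFn_prodFn {e f : GA W → ℂ} (he : IsInfFactor W e) (hf : IsFinFactor W f) :
    IsTestFn W (prodFn W e f) := by
  refine ⟨continuous_prodFn W he.cont hf.cont, ?_⟩
  set Sinf : Set (infinitePart W) := tsupport (fun y : infinitePart W => e (y : GA W)) with hS
  set Sfin : Set (finitePart W) := tsupport (fun y : finitePart W => f (y : GA W)) with hSf
  have hK : IsCompact ((gaSplit W) ⁻¹' (Sinf ×ˢ Sfin)) :=
    (gaSplit W).toHomeomorph.isCompact_preimage.2 (he.compact.prod hf.compact)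
  refine HasCompactSupport.intro hK fun x hx => ?_
  by_contra hne
  apply hx
  rw [Set.mem_preimage, gaSplit_apply' W x]
  have h1 : e (GA.ofInfPart W x) ≠ 0 := fun h => hne (by simp [prodFn, h])
  have h2 : f (GA.ofFinPart W x) ≠ 0 := fun h => hne (by simp [prodFn, h])
  exact ⟨subset_tsupport _ h1, subset_tsupport _ h2⟩

/-- the coordinate law for a right translate by an archimedean element. -/
theorem prodFn_mul_of_mem_infinitePart (e f : GA W → ℂ) {κ : GA W} (hκ : κ ∈ infinitePart W) (x : GA W) :
    prodFn W e f (x * κ) = e (GA.ofInfPart W x * κ) * f (GA.ofFinPart W x) := by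
  unfold prodFn
  rw [ofInfPart_mul, ofInfPart_eq_self_of_mem_infinitePart W hκ, ofFinPart_mul,
    ofFinPart_eq_one_of_mem_infinitePart W hκ, mul_one]

/-- the coordinate law for a right translate by a finite element. -/
theorem prodFn_mul_of_mem_finitePart (e f : GA W → ℂ) {κ : GA W} (hκ : κ ∈ finitePart W) (x : GA W) :
    prodFn W e f (x * κ) = e (GA.ofInfPart W x) * f (GA.ofFinPart W x * κ) := by
  unfold prodFn
  rw [ofInfPart_mul, ofInfPart_eq_one_of_mem_finitePart W hκ, mul_one, ofFinPart_mul,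
    ofFinPart_eq_self_of_mem_finitePart W hκ]

/-- **the right-`(T′_w, −e′)`-equivariance of `e ⊗ f` from that of `e`** (the `equiv₂` field of `TailFamily`, in the
shape ArchApprox's `exists_infFactor_weightEquivariant_archFactor_convInf_ne_zero` delivers for `e`). -/
theorem prodFn_equiv₂ (q : QuadData k) (g g' : Matrix (Fin 4) (Fin 4) k) (eP' eM' : InfinitePlace k → ℤ)
    {e : GA W → ℂ}
    (hequiv : ∀ (w : InfinitePlace k) (κ : GA W), κ ∈ localTorusAt' W w → ∀ x,
      e (x * κ) = weightAt' W q w g g' 0 κ ^ (-eP' w) * weightAt' W q w g g' 1 κ ^ (-eM' w) * e x)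
    (f : GA W → ℂ) :
    ∀ (w : InfinitePlace k) (κ : GA W), κ ∈ localTorusAt' W w → ∀ x,
      prodFn W e f (x * κ) =
        weightAt' W q w g g' 0 κ ^ (-eP' w) * weightAt' W q w g g' 1 κ ^ (-eM' w) * prodFn W e f x := by
  intro w κ hκ x
  have hκinf : κ ∈ infinitePart W := localTorusAt'_subset_infinitePart W w hκ
  rw [prodFn_mul_of_mem_infinitePart W e f hκinf, hequiv w κ hκ]
  unfold prodFn
  ring

/-- **right `K(N)`-invariance of `e ⊗ 1_{K(N)}`** (the `rightInv₂` field). -/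
theorem prodFn_levelInd_mul_of_mem_levelK (e : GA W → ℂ) {N : ℕ}
    {κ : GA W} (hκ : κ ∈ levelK W N) (x : GA W) :
    prodFn W e (levelInd W N) (x * κ) = prodFn W e (levelInd W N) x := by
  rw [prodFn_mul_of_mem_finitePart W e _ (levelK_le_finitePart W N hκ)]
  unfold prodFn
  rw [levelInd_mul_of_mem W hκ]

/-- a compactly supported continuous archimedean factor is bounded. -/
theorem exists_bound_of_isInfFactor {e : GA W → ℂ} (he : IsInfFactor W e) : ∃ M : ℝ, ∀ x, ‖e x‖ ≤ M := by
  obtain ⟨y₀, hy₀⟩ := (he.cont.comp continuous_subtype_val).norm.exists_forall_ge_of_hasCompactSupport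
    (he.compact.norm)
  refine ⟨‖e (y₀ : GA W)‖, fun x => ?_⟩
  rw [he.infOnly x]
  exact hy₀ ⟨GA.ofInfPart W x, GA.ofInfPart_mem_infinitePart W x⟩

/-- **the sup bound of the family `e ⊗ 1_{K(N)}`, uniform in `N`** (the `sup₂` field). -/
theorem exists_bound_prodFn_levelInd {e : GA W → ℂ} (he : IsInfFactor W e) :
    ∃ M₂ : ℝ, ∀ (N : ℕ) (x : GA W), ‖prodFn W e (levelInd W N) x‖ ≤ M₂ := by
  obtain ⟨M, hM⟩ := exists_bound_of_isInfFactor W he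
  refine ⟨M, fun N x => ?_⟩
  unfold prodFn
  rw [norm_mul]
  calc ‖e (GA.ofInfPart W x)‖ * ‖levelInd W N (GA.ofFinPart W x)‖
      ≤ ‖e (GA.ofInfPart W x)‖ * 1 :=
        mul_le_mul_of_nonneg_left (norm_levelInd_le W N _) (norm_nonneg _)
    _ ≤ M := by rw [mul_one]; exact hM _

/-- where `e ⊗ 1_{K(N)}` does not vanish, the finite coordinate lies in `K(N)` (the `suppFin₂` field). -/
theorem ofFinPart_mem_levelK_of_prodFn_levelInd_ne_zero {e : GA W → ℂ} {N : ℕ} {x : GA W}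
    (h : prodFn W e (levelInd W N) x ≠ 0) : GA.ofFinPart W x ∈ levelK W N := by
  by_contra hx
  apply h
  have h0 : levelInd W N (GA.ofFinPart W x) = 0 := by
    rw [levelInd_ofFinPart]
    exact levelInd_eq_zero_of_notMem W hx
  unfold prodFn
  rw [h0, mul_zero]

/-- **one compact carries every `tsupport (e ⊗ 1_{K(N)})`** (the `supp₂` field): `gaSplit⁻¹ (supp e × K(1))`, since
`K(N) ≤ K(1)`. -/
theorem exists_compact_tsupport_prodFn_levelInd {e : GA W → ℂ} (he : IsInfFactor W e) :
    ∃ K : Set (GA W), IsCompact K ∧ ∀ N : ℕ, tsupport (prodFn W e (levelInd W N)) ⊆ K := by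
  set Sinf : Set (infinitePart W) := tsupport (fun y : infinitePart W => e (y : GA W)) with hS
  set K1 : Set (finitePart W) := (Subtype.val : finitePart W → GA W) ⁻¹' (levelK W 1 : Set (GA W)) with hK1
  have hK1c : IsCompact K1 := by
    have hcl : IsClosed K1 := (isClosed_levelK W one_ne_zero).preimage continuous_subtype_val
    have hsub : K1 ⊆ Set.range (fun g : levelK W 1 =>
        (⟨(g : GA W), levelK_le_finitePart W 1 g.2⟩ : finitePart W)) := by
      intro y hy
      exact ⟨⟨(y : GA W), hy⟩, Subtype.ext rfl⟩
    have hrange : IsCompact (Set.range (fun g : levelK W 1 =>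
        (⟨(g : GA W), levelK_le_finitePart W 1 g.2⟩ : finitePart W))) := by
      haveI : CompactSpace (levelK W 1) := isCompact_iff_compactSpace.1 (isCompact_levelK W one_ne_zero)
      exact isCompact_range (continuous_subtype_val.subtype_mk _)
    exact hrange.of_isClosed_subset hcl hsub
  refine ⟨(gaSplit W) ⁻¹' (Sinf ×ˢ K1),
    (gaSplit W).toHomeomorph.isCompact_preimage.2 (he.compact.prod hK1c), fun N => ?_⟩
  -- the set is closed, so it contains the closure of the support
  have hcl : IsClosed ((gaSplit W) ⁻¹' (Sinf ×ˢ K1)) :=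
    (isClosed_tsupport _ |>.prod hK1c.isClosed).preimage (gaSplit W).continuous_toFun
  apply closure_minimal _ hcl
  intro x hx
  rw [Set.mem_preimage, gaSplit_apply' W x]
  have h1 : e (GA.ofInfPart W x) ≠ 0 := fun h => hx (by simp [prodFn, h])
  have h2 : GA.ofFinPart W x ∈ levelK W N :=
    ofFinPart_mem_levelK_of_prodFn_levelInd_ne_zero W hx
  exact ⟨subset_tsupport _ h1, levelK_antitone W (one_dvd N) h2⟩

end ProductWitness

end Summit.Ventures.HodgeRepro.Tier4.Line4

end
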